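import Literature.NumberTheory.Sieve.GreenTao2008MoebiusLogSum
import HarnessLib

/-!
# `∑_{n ≤ x} μ(n) log n / n = −1 + O(exp(−c √log x))`

Topic `Literature/NumberTheory/LFunctions`. Everything in this file is PROVED, as a corollary of two
results of the tree: `m(x) = ∑_{n ≤ x} μ(n)/n ≪ exp(−c₁√log x)`
(`Literature.NumberTheory.LFunctions.abs_sum_moebius_div_le_exp_neg_sqrt_log`, `MoebiusHarmonicSumBound.lean`)
and the logarithmic Riesz mean `M₁(x) = ∑_{n ≤ x} μ(n) log(x/n)/n = 1 + O(exp(−c₂√log x))`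
(`Literature.NumberTheory.Sieve.GreenTao2008.exists_abs_moebiusLogSum_sub_one_le`,
`GreenTao2008MoebiusLogSum.lean`, proved there by the Abelian argument
`∫_1^∞ m(t) dt/t = lim_{δ→0⁺} (δ ζ(1+δ))⁻¹ = 1`), through the identity
`∑_{n ≤ x} μ(n) log n/n = m(x) log x − M₁(x)`:

* `abs_sum_moebius_mul_log_div_add_one_le` — there are `c > 0` and `C` with
  `|∑_{n ≤ x} μ(n) log n / n + 1| ≤ C exp(−c√log x)` for all `x ≥ 2`;
* `tendsto_sum_moebius_mul_log_div` — `∑_{n ≤ N} μ(n) log n / n → −1`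
  (Landau; Montgomery–Vaughan §8.1 (8.8); equivalent to the prime number theorem).

This is the input "`F'(1) = ∏_p (1 − p^{−2})^{−1}`-term" of Matomäki–Merikoski, arXiv:2112.11412, §6
(proof of Lemma 2.4) in real-variable form, through `λ = 𝟙_□ ⋆ μ` (see `LiouvilleHarmonicSum.lean`).

## References

* H. L. Montgomery, R. C. Vaughan, *Multiplicative Number Theory I*, CUP 2007, §8.1, (8.6)–(8.8).
  [cite: MontgomeryVaughan2007, §8.1 (8.8)]
-/

noncomputable section

open Real Filter Topology Finset
open scoped ArithmeticFunction.Moebius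

namespace Literature.NumberTheory.LFunctions

namespace MoebiusLogSum

open Literature.NumberTheory.Sieve.GreenTao2008

/-- `∑_{n ≤ x} μ(n) log n / n = m(x) log x − M₁(x)`. [folklore] -/
theorem sum_moebius_mul_log_div_eq (x : ℝ) :
    ∑ k ∈ Finset.Icc 1 ⌊x⌋₊, (μ k : ℝ) * Real.log k / k =
      moebiusHarmonic x * Real.log x - moebiusLogSum x := by
  rw [moebiusHarmonic_def, moebiusLogSum_def, Finset.sum_mul, ← Finset.sum_sub_distrib]
  refine Finset.sum_congr rfl fun k hk => ?_
  have hk0 : (0 : ℝ) < k := by exact_mod_cast (Finset.mem_Icc.mp hk).1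
  rcases le_or_gt x 0 with hx | hx
  · -- then `⌊x⌋ = 0` and the range is empty: this case cannot occur
    exfalso
    have : ⌊x⌋₊ = 0 := Nat.floor_eq_zero.mpr (by linarith)
    rw [this] at hk
    simp at hk
  · rw [Real.log_div hx.ne' hk0.ne']
    ring

/-- `log x · e^{−a √log x} ≤ 24/a⁴ + 1` for `a > 0`, `x ≥ 1`. [folklore] -/
theorem log_mul_exp_neg_mul_sqrt_le {a : ℝ} (ha : 0 < a) {x : ℝ} (hx : 1 ≤ x) :
    Real.log x * Real.exp (-(a * Real.sqrt (Real.log x))) ≤ 24 / a ^ 4 + 1 := by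
  set u : ℝ := Real.sqrt (Real.log x) with hu
  have hL0 : 0 ≤ Real.log x := Real.log_nonneg hx
  have hu0 : 0 ≤ u := Real.sqrt_nonneg _
  have huL : u ^ 2 = Real.log x := Real.sq_sqrt hL0
  have h24 : 0 ≤ 24 / a ^ 4 := by positivity
  rcases le_or_gt u 1 with hu1 | hu1
  · have h1 : Real.log x ≤ 1 := by nlinarith
    have h2 : Real.exp (-(a * u)) ≤ 1 := Real.exp_le_one_iff.mpr (by nlinarith)
    nlinarith [Real.exp_pos (-(a * u))]
  · have hy : 0 < a * u := by positivity
    have he := MoebiusSum.exp_neg_le_div_pow_four hy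
    have hu2 : 1 ≤ u ^ 2 := by nlinarith
    calc Real.log x * Real.exp (-(a * u)) ≤ u ^ 2 * (24 / (a * u) ^ 4) := by
          rw [← huL]; exact mul_le_mul_of_nonneg_left he (sq_nonneg u)
      _ = 24 / a ^ 4 * (1 / u ^ 2) := by field_simp
      _ ≤ 24 / a ^ 4 * 1 := by
          refine mul_le_mul_of_nonneg_left ?_ h24
          rwa [div_le_one (by positivity)]
      _ ≤ 24 / a ^ 4 + 1 := by linarith

end MoebiusLogSum

open MoebiusLogSum Literature.NumberTheory.Sieve.GreenTao2008 in
/-- **`∑_{n ≤ x} μ(n) log n / n = −1 + O(exp(−c √log x))`** (Landau; Montgomery–Vaughan §8.1,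
(8.8): `∑ μ(n) log n/n = −1`, here with the de la Vallée-Poussin rate): there are `c > 0` and `C`
with `|∑_{n ≤ x} μ(n) log n / n + 1| ≤ C exp(−c√log x)` for all `x ≥ 2`. From
`∑ μ(n) log n/n = m(x) log x − M₁(x)`, `m(x) ≪ e^{−c₁√log x}`, `M₁(x) = 1 + O(e^{−c₂√log x})`.
[cite: MontgomeryVaughan2007, §8.1 (8.8)] -/
theorem abs_sum_moebius_mul_log_div_add_one_le :
    ∃ c : ℝ, 0 < c ∧ ∃ C : ℝ, ∀ x : ℝ, 2 ≤ x →
      |∑ k ∈ Finset.Icc 1 ⌊x⌋₊, (μ k : ℝ) * Real.log k / k + 1| ≤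
        C * Real.exp (-c * Real.sqrt (Real.log x)) := by
  obtain ⟨c₁, hc₁, C₁, hm⟩ := abs_sum_moebius_div_le_exp_neg_sqrt_log
  obtain ⟨c₂, hc₂, C₂, hC₂, hM⟩ := exists_abs_moebiusLogSum_sub_one_le
  set c : ℝ := min (c₁ / 2) c₂ with hc
  have hc0 : 0 < c := lt_min (half_pos hc₁) hc₂
  set C₁' : ℝ := max C₁ 0 with hC₁'
  refine ⟨c, hc0, C₁' * (24 / (c₁ / 2) ^ 4 + 1) + C₂, fun x hx => ?_⟩
  have hx1 : 1 ≤ x := by linarith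
  set u : ℝ := Real.sqrt (Real.log x) with hu
  have hu0 : 0 ≤ u := Real.sqrt_nonneg _
  have hL0 : 0 ≤ Real.log x := Real.log_nonneg hx1
  -- the identity
  have hid : ∑ k ∈ Finset.Icc 1 ⌊x⌋₊, (μ k : ℝ) * Real.log k / k + 1 =
      moebiusHarmonic x * Real.log x - (moebiusLogSum x - 1) := by
    rw [sum_moebius_mul_log_div_eq]; ring
  rw [hid]
  -- the two bounds
  have h1 : |moebiusHarmonic x * Real.log x| ≤ C₁' * (24 / (c₁ / 2) ^ 4 + 1) * Real.exp (-(c * u)) := by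
    rw [abs_mul, abs_of_nonneg hL0, moebiusHarmonic_def]
    have hmx : |∑ k ∈ Finset.Icc 1 ⌊x⌋₊, (μ k : ℝ) / k| ≤ C₁' * Real.exp (-(c₁ * u)) := by
      refine (hm x hx).trans ?_
      rw [neg_mul]
      exact mul_le_mul_of_nonneg_right (le_max_left _ _) (Real.exp_pos _).le
    have hkey := log_mul_exp_neg_mul_sqrt_le (half_pos hc₁) hx1
    have hsplit : Real.exp (-(c₁ * u)) = Real.exp (-(c₁ / 2 * u)) * Real.exp (-(c₁ / 2 * u)) := by
      rw [← Real.exp_add]; ring_nf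
    have hcu : Real.exp (-(c₁ / 2 * u)) ≤ Real.exp (-(c * u)) :=
      Real.exp_le_exp.mpr (by nlinarith [min_le_left (c₁ / 2) c₂])
    calc |∑ k ∈ Finset.Icc 1 ⌊x⌋₊, (μ k : ℝ) / k| * Real.log x
        ≤ C₁' * Real.exp (-(c₁ * u)) * Real.log x := mul_le_mul_of_nonneg_right hmx hL0
      _ = C₁' * (Real.log x * Real.exp (-(c₁ / 2 * u))) * Real.exp (-(c₁ / 2 * u)) := by
          rw [hsplit]; ring
      _ ≤ C₁' * (24 / (c₁ / 2) ^ 4 + 1) * Real.exp (-(c * u)) :=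
          mul_le_mul (mul_le_mul_of_nonneg_left hkey (le_max_right _ _)) hcu (Real.exp_pos _).le
            (by positivity)
  have h2 : |moebiusLogSum x - 1| ≤ C₂ * Real.exp (-(c * u)) := by
    refine (hM x hx).trans (mul_le_mul_of_nonneg_left ?_ hC₂)
    exact Real.exp_le_exp.mpr (by nlinarith [min_le_right (c₁ / 2) c₂])
  calc |moebiusHarmonic x * Real.log x - (moebiusLogSum x - 1)|
      ≤ |moebiusHarmonic x * Real.log x| + |moebiusLogSum x - 1| := abs_sub _ _
    _ ≤ C₁' * (24 / (c₁ / 2) ^ 4 + 1) * Real.exp (-(c * u)) + C₂ * Real.exp (-(c * u)) :=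
        add_le_add h1 h2
    _ = (C₁' * (24 / (c₁ / 2) ^ 4 + 1) + C₂) * Real.exp (-c * Real.sqrt (Real.log x)) := by
        rw [hu]; ring

/-- **`∑_{n=1}^∞ μ(n) log n / n = −1`**: the partial sums tend to `−1`.
[cite: MontgomeryVaughan2007, §8.1 (8.8)] -/
theorem tendsto_sum_moebius_mul_log_div :
    Tendsto (fun N : ℕ => ∑ k ∈ Finset.Icc 1 N, (μ k : ℝ) * Real.log k / k) atTop (𝓝 (-1)) := by
  obtain ⟨c, hc, C, h⟩ := abs_sum_moebius_mul_log_div_add_one_le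
  have hlim : Tendsto (fun N : ℕ => C * Real.exp (-c * Real.sqrt (Real.log N))) atTop
      (𝓝 (C * 0)) := by
    refine Tendsto.const_mul C ?_
    refine Real.tendsto_exp_atBot.comp ?_
    have h1 : Tendsto (fun N : ℕ => Real.sqrt (Real.log N)) atTop atTop :=
      Real.tendsto_sqrt_atTop.comp (Real.tendsto_log_atTop.comp tendsto_natCast_atTop_atTop)
    exact h1.const_mul_atTop_of_neg (by linarith : -c < 0)
  rw [mul_zero] at hlim
  have key : Tendsto (fun N : ℕ => ∑ k ∈ Finset.Icc 1 N, (μ k : ℝ) * Real.log k / k + 1) atTop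
      (𝓝 0) := by
    refine squeeze_zero_norm' ?_ hlim
    filter_upwards [eventually_ge_atTop 2] with N hN
    rw [Real.norm_eq_abs]
    have := h N (by exact_mod_cast hN)
    rwa [Nat.floor_natCast] at this
  have := key.add_const (-1)
  simpa using this

end Literature.NumberTheory.LFunctions
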